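import Summits.BirchSwinnertonDyer.BirchSwinnertonDyer.Theorems.ErratumRoadFiveRest3NoWitnessOffLocusKolyvaginTam
import Summits.BirchSwinnertonDyer.Rank1Residual.X11b.BDPRouteSources
import HarnessLib

/-!
# Route `ErratumRoadFive` (rung K2), crux `Rest3NoWitnessBranchAtFive` (item stmt-BirchSwinnertonDyer-19703), stub
# `stub_nw_offLocus`: its PRE-BY-CITATION part and its genuine RESIDUE — the registered signature VERBATIM from the
# published facts, TWO preprint statements AS PRINTED (Skinner–Zhang arXiv:1407.1099 Thm. 1.2 on its locus (a)–(e);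
# Castella's erratum Thm. A′ on its locus, witness `q = 2` allowed) and the refined ♯-input `hZt` asked ONLY on the
# rows BOTH preprints miss (cell `bsd-stepL`, ACCEL seat `bsd-stepL-nw1` g0; `--supports stmt-BirchSwinnertonDyer-19703`;
# Theses-FREE imports)

HONEST FRAMING. THEOREMS ONLY (no definition, no named fact, no `sorry`). The two preprint statements enter as the
tree's `_OPEN`-tagged hypothesis binders `SkinnerZhang2014.thm1_2_padicVal_bsd_rankOne_OPEN` (`hSZ`) and
`Castella2018.erratum_thmAprime_padicVal_bsd_rankOne_OPEN` (`hA'`) — UNREFEREED claims [claim: SkinnerZhang2014,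
status: under-review] [claim: Castella2018Erratum, status: under-review], used exactly as imc-p1's
`Koly.kolyvaginFramesHLAt_of_skinnerZhang_OPEN` (`ErratumRoadFiveKolyvaginFramesTight.lean` §4) and multr1-p2's
`indexLowerBoundAt_of_thmAprime_OPEN` (`BDPRouteSources.lean`) use them: «PRE-covered by citation», never «proved».
`hZt` (W. Zhang's refined non-vanishing at a multiplicative `p`) is conjecture-grade. BSD is proved for no pair;
nothing is booked; no census word moves (T7).

THE POINT. On (NW) ∩ off-Locus (cw 18 793) two sub-populations are reached by a PREPRINT AS PRINTED through
`BSD(E,p)` and multr1-p2's tightness `P2.openInputOnTreeAt_of_bsdp_of_ram` — the parity of the auxiliary field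
inside the preprint's proof being irrelevant to the tree:
* (SZ) Skinner–Zhang's locus `SkinnerZhang2014.Hypotheses W p` — (b) `p ∤ v_p(Δ_min)` (+ the 𝓛-condition at split
  `p`), (d) every multiplicative `ℓ ≡ ±1 (mod p)` has `p ∤ v_ℓ(Δ_min)` (so every Tamagawa-`p` prime is `≢ ±1`), (e)
  two `E[p]`-ramified `ℓ ∥ N` (`ℓ = p` allowed): NO `p ∤ c_ℓ` clause — the preprint's own `N⁻` absorbs the Tamagawa
  primes `ℓ ≢ ±1 (mod p)` (koly MEMO-v6 Part A: 53–60 % of the whole Tamagawa atom; tree bridge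
  `bsdp_of_skinnerZhang_OPEN`);
* (A′₂) the «only-`q = 2`» rows: `2 ∥ N` NON-split with `p ∤ v_2(Δ_min)` is an erratum witness AS PRINTED (Thm. A′ has
  no parity clause on `q`; `X11.AprimeLocusAt W p` allows `q = 2`; tree bridge `bsdp_of_erratumHypotheses_of_thmAprime_OPEN`)
  — the «even-`d_K` erratum field» lives inside Castella's proof, not in the tree's odd-`d_K` data.
The RESIDUE of the stub — no non-split `E[p]`-ramified witness at all (not even `2`) AND outside Skinner–Zhang's locus
(`p ∣ v_p(Δ_min)`, or split `p` off the 𝓛-condition, or a Tamagawa-`p` prime `ℓ ≡ ±1 (mod p)`) — is where the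
refined ♯-input `hZt` of `ErratumRoadFiveRest3NoWitnessOffLocusKolyvaginTam.lean` is genuinely needed.

* `stub_nw_offLocus_of_skinnerZhang_OPEN_of_thmAprime_OPEN_of_kolyvaginTamResidue` — THE REGISTERED SIGNATURE
  VERBATIM ⟸ published facts + `hMc` + `h36` + `h331` + `hSZ` + `hA'` + `hZt` asked only on the residue rows.

References: [SkinnerZhang2014] Thm. 1.1 (a)–(e), Thm. 1.2; [Castella2018Erratum] Thm. A′ and Remark (1)–(2);
[McCallumLMS1991] §5 Cor. 5.6; [JetchevSkinnerWan2017] Thm. 3.3.1, §7.4.1; [Darmon2004] Thm. 3.6.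
-/

-- the Theorems namespace of this sub repeats the summit name by design (D-0017 nested layout)
set_option linter.dupNamespace false

noncomputable section

open scoped Classical

namespace Summit.BirchSwinnertonDyer.BirchSwinnertonDyer.Theorems

open WeierstrassCurve NumberField Literature.NumberTheory.EllipticCurves
  Literature.NumberTheory.EllipticCurves.ModularForms
  Literature.NumberTheory.EllipticCurves.Rank1Residual
  Literature.NumberTheory.EllipticCurves.Rank1Residual.Typed
  Summit.BirchSwinnertonDyer.Rank1Residual Summit.BirchSwinnertonDyer.Rank1Residual.X11b
  Summit.BirchSwinnertonDyer.Rank1Residual.X11b.Three.Koly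

/-- **`stub_nw_offLocus` (crux 19703; registered signature VERBATIM) from two preprints AS PRINTED plus the refined
♯-input on the residue.** For every (NW) ∩ off-Locus pair ((ram), `E(ℚ_p)[p] = 0`, no odd non-split `E[p]`-ramified
multiplicative `q ≠ p`, `p ∣ ∏ c_ℓ`): route p2's open input `P2OpenInputOnTreeAt W p`, from the published named facts
(`hGZ hKo hSk hGZK hmod hnf hHL hMaz hrec`), McCallum (`hMc`), Darmon 3.6 (`h36`), JSW17 Thm. 3.3.1-mult (`h331`), and:
`hSZ` — Skinner–Zhang Thm. 1.2 AS PRINTED (`_OPEN` binder; gives `BSD(E,p)` on `SkinnerZhang2014.Hypotheses W p` via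
`bsdp_of_skinnerZhang_OPEN`); `hA'` — Castella's Thm. A′ AS PRINTED (`_OPEN` binder; gives `BSD(E,p)` on
`ErratumHypotheses W p`, witness `q = 2` allowed, via `bsdp_of_erratumHypotheses_of_thmAprime_OPEN`); `hZt` — a
Kolyvagin certificate of level `M + 1`, `M ≤ ord_p ∏ c_ℓ(E)`, at the Hoffstein–Luo frames, asked ONLY on the RESIDUE
rows (`¬ X11.AprimeLocusAt W p ∧ ¬ SkinnerZhang2014.Hypotheses W p` on top of the (NW) ∩ off-Locus binders). Inside
the open input's binders the pair is in X11b with `p ≥ 5` and `ρ̄` onto: on (SZ) ∪ (A′₂) `BSD(E,p)` by citation and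
multr1-p2's tightness `P2.openInputOnTreeAt_of_bsdp_of_ram`; on the residue the Tamagawa-refined road
`openInputOnTreeAt_of_kolyvaginTamFramesHLAt`. CONDITIONAL on every binder — two of them UNREFEREED claims, one
conjecture-grade; nothing booked; BSD is proved for no pair. [claim: SkinnerZhang2014, status: under-review]
[claim: Castella2018Erratum, status: under-review] [cite: SkinnerZhang2014, Thm. 1.1 (a)–(e) and Thm. 1.2 (arXiv:1407.1099v1 pp. 1–2)]
[cite: Castella2018Erratum, Thm. A′ and Remark (1)–(2) (pp. 1–2)] [cite: McCallumLMS1991, §5 Cor. 5.6 (p. 310)]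
[cite: JetchevSkinnerWan2017, Thm. 3.3.1, §7.4.1] [cite: Darmon2004, Thm. 3.6] -/
theorem stub_nw_offLocus_of_skinnerZhang_OPEN_of_thmAprime_OPEN_of_kolyvaginTamResidue
    (hGZ : ∀ (N : ℕ) [NeZero N] (W : WeierstrassCurve ℚ) (K : Type) [Field K] [NumberField K],
      gross_zagier N W K)
    (hKo : ∀ (N : ℕ) [NeZero N] (W : WeierstrassCurve ℚ) (K : Type) [Field K] [NumberField K],
      kolyvagin N W K)
    (hSk : Skinner2016.thmC_padicValRat_bsd_rank_zero)
    (hGZK : rank_eq_analyticRank_of_analyticRank_le_one) (hmod : hasEntireLFunction_rat)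
    (hnf : exists_isNewformOf) (hHL : HoffsteinLuo1997_exists_twist_L_one_ne_zero)
    (hMaz : mazur_not_dvd_maninConstant_of_odd)
    (hrec : ∀ (N : ℕ) [NeZero N] (W : WeierstrassCurve ℚ) (K : Type) [Field K] [NumberField K],
      heegnerPointOfConductor_one_galoisConj N W K)
    (hMc : McCallum1991_pow_dvd_card_sha_primary_of_certificate)
    (h36 : ∀ (N : ℕ) [NeZero N] (W : WeierstrassCurve ℚ) (K : Type) [Field K] [NumberField K],
      phi_heegnerTau_mem_range_map_singularModuliField N W K)
    (h331 : JetchevSkinnerWan2017.thm331_anticyclotomicControl_mult)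
    -- two PREPRINT statements AS PRINTED (`_OPEN` binders; unrefereed claims)
    (hSZ : SkinnerZhang2014.thm1_2_padicVal_bsd_rankOne_OPEN)
    (hA' : Castella2018.erratum_thmAprime_padicVal_bsd_rankOne_OPEN)
    -- refined Kolyvagin non-vanishing, ∀-frame ♯ typing, asked ONLY on the RESIDUE of (NW) ∩ off-Locus
    (hZt : ∀ (W : WeierstrassCurve ℚ) [W.IsElliptic] [W.IsGloballyMinimal] [NeZero (W.conductorNorm ℤ)]
      (p : ℕ) [Fact p.Prime] (K : Type) [Field K] [NumberField K]
      (Dt : ModularParametrizationData W (W.conductorNorm ℤ)) (β : ℤ) (ι : K →+* ℂ),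
      ClassX11b W p → 5 ≤ p → W.HasMultiplicativeReductionAtPrime p → Rank1Residual.Surj W p →
      Rank1Residual.Ram W p → p ∣ W.tamagawaProduct →
      (∀ P : (W.baseChange ℚ_[p]).toAffine.Point, p • P = 0 → P = 0) →
      (∀ (q : ℕ) [Fact q.Prime], q ≠ 2 → q ≠ p → Rank1Residual.Mult W q →
        ¬ W.HasSplitMultiplicativeReductionAtPrime q → p ∣ padicValInt q W.minimalDiscriminantInt) →
      ¬ X11.AprimeLocusAt W p → ¬ SkinnerZhang2014.Hypotheses W p →
      IsImaginaryQuadratic K → Odd (NumberField.discr K) →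
      SatisfiesHeegnerHypothesis (W.conductorNorm ℤ) K →
      (W.quadraticTwist (NumberField.discr K : ℚ)).entireLFunction 1 ≠ 0 →
      NumberField.discr K ≠ -3 →
      (4 * (W.conductorNorm ℤ : ℤ)) ∣ β ^ 2 - NumberField.discr K → ¬ (p : ℤ) ∣ Dt.c →
      ∃ M : ℕ, M ≤ padicValNat p W.tamagawaProduct ∧ CertificateAt Dt β ι p M) :
    ∀ (W : WeierstrassCurve ℚ) [W.IsElliptic] [W.IsGloballyMinimal] (p : ℕ) [Fact p.Prime],
      Literature.NumberTheory.EllipticCurves.Rank1Residual.Ram W p →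
      (∀ P : (W.baseChange ℚ_[p]).toAffine.Point, p • P = 0 → P = 0) →
      ¬ (∃ (q : ℕ) (_ : Fact q.Prime), q ≠ 2 ∧ q ≠ p ∧ Literature.NumberTheory.EllipticCurves.Rank1Residual.Mult W q ∧
          ¬ W.HasSplitMultiplicativeReductionAtPrime q ∧ ¬ p ∣ padicValInt q W.minimalDiscriminantInt) →
      p ∣ W.tamagawaProduct →
      Summit.BirchSwinnertonDyer.Rank1Residual.X11b.P2OpenInputOnTreeAt W p := by
  intro W _ _ p hp hram htf hnw htam N _ K _ _ Dt H ι P hX hp5 hs hN hK hodd hpd hμ hHN hLt hP hc hPinf κ hκ γ _ 𝔭 h𝔭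
    he hf
  haveI : NeZero (W.conductorNorm ℤ) := ⟨(W.conductorNorm_pos_holds).ne'⟩
  have hmult : W.HasMultiplicativeReductionAtPrime p := hX.2.2.1
  have hirr : Irr W p := hX.2.2.2
  have hC : P2ControlOnTreeAt W p := p2ControlOnTreeAt_of_thm331Mult W p h331 hKo
  -- (A′₂): an erratum witness AS PRINTED (here necessarily `q = 2`) ⟹ BSD(E,p) by citation ⟹ the open input
  by_cases hA : X11.AprimeLocusAt W p
  · have hbsd : BSDp W p :=
      bsdp_of_erratumHypotheses_of_thmAprime_OPEN W p hA' hGZK ⟨hp5, hmult, hirr, hA⟩ hX.1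
    exact P2.openInputOnTreeAt_of_bsdp_of_ram W p hGZ hKo hSk hGZK hmod hC hram hbsd N K Dt H ι P hX hp5 hs hN hK
      hodd hpd hμ hHN hLt hP hc hPinf κ hκ γ 𝔭 h𝔭 he hf
  -- (SZ): Skinner–Zhang's locus (a)–(e) ⟹ BSD(E,p) by citation ⟹ the open input
  by_cases hH : SkinnerZhang2014.Hypotheses W p
  · have hbsd : BSDp W p := bsdp_of_skinnerZhang_OPEN W p hSZ hGZK hp5 hH hX.1
    exact P2.openInputOnTreeAt_of_bsdp_of_ram W p hGZ hKo hSk hGZK hmod hC hram hbsd N K Dt H ι P hX hp5 hs hN hK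
      hodd hpd hμ hHN hLt hP hc hPinf κ hκ γ 𝔭 h𝔭 he hf
  -- the residue: the Tamagawa-refined Kolyvagin road
  have hα : ∀ (q : ℕ) [Fact q.Prime], q ≠ 2 → q ≠ p → Rank1Residual.Mult W q →
      ¬ W.HasSplitMultiplicativeReductionAtPrime q → p ∣ padicValInt q W.minimalDiscriminantInt := by
    intro q _ hq2 hqp hmq hnsq
    by_contra hv
    exact hnw ⟨q, inferInstance, hq2, hqp, hmq, hnsq, hv⟩
  exact openInputOnTreeAt_of_kolyvaginTamFramesHLAt hGZ hKo hSk hGZK hmod hnf hHL hMaz hrec hMc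
    (kolyvaginRoadThree_hKD_of_darmon36 h36) W p hX hram hC
    (fun K' _ _ Dt' β ι' hK' hodd' hHN' hLt' h3' hβ hc' ↦
      hZt W p K' Dt' β ι' hX hp5 hmult hs hram htam htf hα hA hH hK' hodd' hHN' hLt' h3' hβ hc')
    N K Dt H ι P hX hp5 hs hN hK hodd hpd hμ hHN hLt hP hc hPinf κ hκ γ 𝔭 h𝔭 he hf

end Summit.BirchSwinnertonDyer.BirchSwinnertonDyer.Theorems

end
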